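import Summits.Ventures.WeilGRH.FlatWindowMeanDefect
import HarnessLib

/-!
# GRH arm (rh-explicit, venture WeilGRH): RUNGS AT DIFFERENT WINDOWS ARE COUPLED — a Cauchy–Schwarz law
  for the flat-window defects at the four windows `a₁, a₂, a₁ + a₂, a₁ − a₂`

Cell `rh-explicit`, WEIL TRACK (structure seat weil-3, gen9).  Every statement of the arm so far is about
ONE window (or the limit `a → ∞`).  `FlatWindowMeanDefect.flatWindow_defect_eq` writes the defect of the
flat-window rung inequality at window `a` as `a·D(a) = E(a) := ∫ 2sin²(at)/t² dμ(t)` for any representing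
measure `μ`; since `sin²α − sin²β = sin(α+β)sin(α−β)`, Cauchy–Schwarz in `L²(μ)` couples the windows:

* `sq_integral_mul_le`: Cauchy–Schwarz `(∫uv)² ≤ ∫u²∫v²` for real integrands (the quadratic in `λ`);
* **`sq_sub_fejerEnergy_le`** (any measure with `t⁻² ∈ L¹`): `(E(a₁) − E(a₂))² ≤ E(a₁+a₂)·E(a₁−a₂)`;
  `sq_sub_fejerEnergy_le_krein`: `≤ 2(∫t⁻²dμ)·E(a₁−a₂)` — `E` is ½-Hölder in the window with modulus the
  energy at the DIFFERENCE window (Krein's inequality for the positive-definite function `M₂ − E(ξ/2)`);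
* **`sq_sub_defect_le`** (rung language): for `χ` mod `q ≠ 1` and every positive `μ` representing `Q_χ` on
  all tests with `t⁻² ∈ L¹(μ)`, for all `a₁ > a₂ > 0`:
  `(a₁D(a₁) − a₂D(a₂))² ≤ (a₁+a₂)D(a₁+a₂) · (a₁−a₂)D(a₁−a₂)`,
  `D(a) = log q − K_κ + I_κ(a)/a − 2S_χ(a) − 2a·μ{0}` — a quadratic constraint among the smoothed prime sums
  at four windows (for `a₁ − a₂ ≤ (log 2)/2` the last factor is PRIME-FREE and explicit).

Numerically (`ζ`, RH-world, structure seat tools/crosswindow.py): on the 55 pairs from the grid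
`{0.1, …, 3}` the law holds with worst ratio `0.139` (`a₁ = 2`, `a₂ = 0.1`); the prime-free energies
`E(b) = 16 sinh²(b/2) − bK₀ + I₀(b)`, `b ≤ (log 2)/2`, are `0.053 / 0.054 / 0.041 / 0.047 / 0.064` at
`b = 0.05 / 0.1 / 0.2 / 0.3 / 0.3465` (`= Σ_ρ 2sin²(bγ)/γ²` under RH: sum rules for the zeros from windows
with no primes).  No definitions, no named facts, RH/GRH-free.
-/

set_option autoImplicit false

noncomputable section

open Complex Filter Set MeasureTheory
open scoped Real Topology ComplexConjugate ArithmeticFunction.vonMangoldt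

namespace Summit.Ventures.WeilGRH

open Literature.NumberTheory.LFunctions

variable {q : ℕ}

/-! ## Cauchy–Schwarz for real integrands -/

/-- **Cauchy–Schwarz** for real functions against a measure: `(∫ u v)² ≤ (∫ u²)(∫ v²)` when `u²`, `v²`,
`u·v` are integrable (the quadratic `λ ↦ ∫ (u − λv)² ≥ 0`). -/
theorem sq_integral_mul_le {μ : Measure ℝ} {u v : ℝ → ℝ} (hu : Integrable (fun t ↦ u t ^ 2) μ)
    (hv : Integrable (fun t ↦ v t ^ 2) μ) (huv : Integrable (fun t ↦ u t * v t) μ) :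
    (∫ t, u t * v t ∂μ) ^ 2 ≤ (∫ t, u t ^ 2 ∂μ) * ∫ t, v t ^ 2 ∂μ := by
  set U := ∫ t, u t ^ 2 ∂μ with hU
  set V := ∫ t, v t ^ 2 ∂μ with hV
  set P := ∫ t, u t * v t ∂μ with hP
  have hU0 : 0 ≤ U := integral_nonneg fun t ↦ by positivity
  have hV0 : 0 ≤ V := integral_nonneg fun t ↦ by positivity
  -- `0 ≤ ∫ (u − λ v)² = U − 2λP + λ²V` for every `λ`
  have hquad : ∀ l : ℝ, 0 ≤ U - 2 * l * P + l ^ 2 * V := by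
    intro l
    have hint : Integrable (fun t ↦ (u t - l * v t) ^ 2) μ := by
      have h := (hu.sub (huv.const_mul (2 * l))).add (hv.const_mul (l ^ 2))
      refine h.congr (Eventually.of_forall fun t ↦ ?_)
      show u t ^ 2 - 2 * l * (u t * v t) + l ^ 2 * v t ^ 2 = (u t - l * v t) ^ 2
      ring
    have h0 : 0 ≤ ∫ t, (u t - l * v t) ^ 2 ∂μ := integral_nonneg fun t ↦ by positivity
    have e : ∫ t, (u t - l * v t) ^ 2 ∂μ = U - 2 * l * P + l ^ 2 * V := by
      have hP' : Integrable (fun t ↦ 2 * l * (u t * v t)) μ := huv.const_mul _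
      have hA : Integrable (fun t ↦ u t ^ 2 - 2 * l * (u t * v t)) μ := hu.sub hP'
      have hB : Integrable (fun t ↦ l ^ 2 * v t ^ 2) μ := hv.const_mul _
      have e1 : ∫ t, (u t - l * v t) ^ 2 ∂μ = ∫ t, (u t ^ 2 - 2 * l * (u t * v t)) + l ^ 2 * v t ^ 2 ∂μ :=
        integral_congr_ae (Eventually.of_forall fun t ↦ by show (u t - l * v t) ^ 2 = _; ring)
      rw [e1, integral_add hA hB, integral_sub hu hP', integral_const_mul, integral_const_mul]
    linarith
  rcases hV0.eq_or_lt with hV00 | hVpos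
  · -- `V = 0`: then `P = 0` (take `λ = ± large`)
    have hP0 : P = 0 := by
      by_contra hP0
      have h1 := hquad ((U + 1) / (2 * P))
      have h2 := hquad (-((U + 1) / (2 * P)))
      rw [← hV00] at h1 h2
      have e1 : U - 2 * ((U + 1) / (2 * P)) * P + ((U + 1) / (2 * P)) ^ 2 * 0 = -1 := by field_simp; ring
      linarith [e1]
    rw [hP0, ← hV00]; simp
  · have h := hquad (P / V)
    have e : U - 2 * (P / V) * P + (P / V) ^ 2 * V = U - P ^ 2 / V := by field_simp; ring
    rw [e] at h
    have : P ^ 2 / V ≤ U := by linarith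
    rwa [div_le_iff₀ hVpos] at this

/-! ## The Fejér energies `E(b) = ∫ 2sin²(bt)/t² dμ` and their cross-window law -/

/-- `t ↦ 2sin²(bt)/t²` is `μ`-integrable when `t⁻²` is (it is `≤ 2t⁻²`; `0` at the centre). -/
theorem integrable_fejerEnergy {μ : Measure ℝ} (hM : Integrable (fun t : ℝ ↦ (t ^ 2)⁻¹) μ) (b : ℝ) :
    Integrable (fun t : ℝ ↦ 2 * Real.sin (b * t) ^ 2 / t ^ 2) μ := by
  refine (hM.const_mul 2).mono' (by fun_prop : Measurable fun t : ℝ ↦ 2 * Real.sin (b * t) ^ 2 / t ^ 2).aestronglyMeasurable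
    (Eventually.of_forall fun t ↦ ?_)
  rw [Real.norm_of_nonneg (by positivity), div_eq_mul_inv]
  exact mul_le_mul_of_nonneg_right (by nlinarith [Real.sin_sq_le_one (b * t)]) (by positivity)

/-- `sin(pt)sin(rt)/t²` is `μ`-integrable when `t⁻²` is. -/
theorem integrable_sin_mul_sin_div_sq {μ : Measure ℝ} (hM : Integrable (fun t : ℝ ↦ (t ^ 2)⁻¹) μ) (p r : ℝ) :
    Integrable (fun t : ℝ ↦ Real.sin (p * t) / t * (Real.sin (r * t) / t)) μ := by
  refine hM.mono' (by fun_prop : Measurable fun t : ℝ ↦ Real.sin (p * t) / t * (Real.sin (r * t) / t)).aestronglyMeasurable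
    (Eventually.of_forall fun t ↦ ?_)
  rw [Real.norm_eq_abs, abs_mul, abs_div, abs_div]
  rcases eq_or_ne t 0 with rfl | ht
  · simp
  · have h1 := Real.abs_sin_le_one (p * t)
    have h2 := Real.abs_sin_le_one (r * t)
    have ht' : 0 < |t| := abs_pos.2 ht
    calc |Real.sin (p * t)| / |t| * (|Real.sin (r * t)| / |t|) ≤ 1 / |t| * (1 / |t|) := by
          gcongr
      _ = (t ^ 2)⁻¹ := by rw [← sq_abs]; field_simp

/-- `(sin(pt)/t)² = sin²(pt)/t²` integrates to `E(p)/2`. -/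
theorem integral_sin_div_sq {μ : Measure ℝ} (p : ℝ) :
    ∫ t, (Real.sin (p * t) / t) ^ 2 ∂μ = (∫ t, 2 * Real.sin (p * t) ^ 2 / t ^ 2 ∂μ) / 2 := by
  rw [eq_div_iff two_ne_zero, mul_comm, ← integral_const_mul]
  refine integral_congr_ae (Eventually.of_forall fun t ↦ ?_)
  show 2 * (Real.sin (p * t) / t) ^ 2 = 2 * Real.sin (p * t) ^ 2 / t ^ 2
  rw [div_pow]; ring

/-- **THE CROSS-WINDOW LAW (measure level).**  For every measure `μ` on `ℝ` with `t⁻² ∈ L¹(μ)` and all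
`a₁, a₂ ∈ ℝ`, the Fejér energies `E(b) := ∫ 2sin²(bt)/t² dμ(t)` satisfy

  `(E(a₁) − E(a₂))² ≤ E(a₁ + a₂) · E(a₁ − a₂)`

(`sin²α − sin²β = sin(α+β)sin(α−β)` and Cauchy–Schwarz in `L²(μ)`). -/
theorem sq_sub_fejerEnergy_le {μ : Measure ℝ} (hM : Integrable (fun t : ℝ ↦ (t ^ 2)⁻¹) μ) (a₁ a₂ : ℝ) :
    ((∫ t, 2 * Real.sin (a₁ * t) ^ 2 / t ^ 2 ∂μ) - ∫ t, 2 * Real.sin (a₂ * t) ^ 2 / t ^ 2 ∂μ) ^ 2 ≤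
      (∫ t, 2 * Real.sin ((a₁ + a₂) * t) ^ 2 / t ^ 2 ∂μ) * ∫ t, 2 * Real.sin ((a₁ - a₂) * t) ^ 2 / t ^ 2 ∂μ := by
  set u : ℝ → ℝ := fun t ↦ Real.sin ((a₁ + a₂) * t) / t with hu
  set v : ℝ → ℝ := fun t ↦ Real.sin ((a₁ - a₂) * t) / t with hv
  have hu2 : Integrable (fun t ↦ u t ^ 2) μ := by
    have h := (integrable_fejerEnergy hM (a₁ + a₂)).div_const 2
    refine h.congr (Eventually.of_forall fun t ↦ ?_)
    show 2 * Real.sin ((a₁ + a₂) * t) ^ 2 / t ^ 2 / 2 = (Real.sin ((a₁ + a₂) * t) / t) ^ 2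
    rw [div_pow]; ring
  have hv2 : Integrable (fun t ↦ v t ^ 2) μ := by
    have h := (integrable_fejerEnergy hM (a₁ - a₂)).div_const 2
    refine h.congr (Eventually.of_forall fun t ↦ ?_)
    show 2 * Real.sin ((a₁ - a₂) * t) ^ 2 / t ^ 2 / 2 = (Real.sin ((a₁ - a₂) * t) / t) ^ 2
    rw [div_pow]; ring
  have huv : Integrable (fun t ↦ u t * v t) μ := integrable_sin_mul_sin_div_sq hM _ _
  -- the difference of energies is `2 ∫ u v`
  have hdiff : (∫ t, 2 * Real.sin (a₁ * t) ^ 2 / t ^ 2 ∂μ) - ∫ t, 2 * Real.sin (a₂ * t) ^ 2 / t ^ 2 ∂μ =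
      2 * ∫ t, u t * v t ∂μ := by
    rw [← integral_sub (integrable_fejerEnergy hM a₁) (integrable_fejerEnergy hM a₂), ← integral_const_mul]
    refine integral_congr_ae (Eventually.of_forall fun t ↦ ?_)
    show 2 * Real.sin (a₁ * t) ^ 2 / t ^ 2 - 2 * Real.sin (a₂ * t) ^ 2 / t ^ 2 =
      2 * (Real.sin ((a₁ + a₂) * t) / t * (Real.sin ((a₁ - a₂) * t) / t))
    have key : Real.sin (a₁ * t) ^ 2 - Real.sin (a₂ * t) ^ 2 =
        Real.sin ((a₁ + a₂) * t) * Real.sin ((a₁ - a₂) * t) := by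
      rw [add_mul, sub_mul, Real.sin_add, Real.sin_sub]
      nlinarith [Real.sin_sq_add_cos_sq (a₁ * t), Real.sin_sq_add_cos_sq (a₂ * t)]
    have e2 : Real.sin ((a₁ + a₂) * t) / t * (Real.sin ((a₁ - a₂) * t) / t) =
        (Real.sin (a₁ * t) ^ 2 - Real.sin (a₂ * t) ^ 2) / t ^ 2 := by
      rw [div_mul_div_comm, ← key, ← pow_two]
    rw [e2]
    ring
  have hCS := sq_integral_mul_le hu2 hv2 huv
  rw [hdiff, integral_sin_div_sq (μ := μ) (a₁ + a₂), integral_sin_div_sq (μ := μ) (a₁ - a₂)] at *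
  nlinarith [hCS]

/-- `E(b) ≤ 2∫t⁻²dμ`. -/
theorem fejerEnergy_le {μ : Measure ℝ} (hM : Integrable (fun t : ℝ ↦ (t ^ 2)⁻¹) μ) (b : ℝ) :
    ∫ t, 2 * Real.sin (b * t) ^ 2 / t ^ 2 ∂μ ≤ 2 * ∫ t, (t ^ 2)⁻¹ ∂μ := by
  rw [← integral_const_mul]
  refine integral_mono (integrable_fejerEnergy hM b) (hM.const_mul 2) fun t ↦ ?_
  show 2 * Real.sin (b * t) ^ 2 / t ^ 2 ≤ 2 * (t ^ 2)⁻¹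
  rw [div_eq_mul_inv]
  exact mul_le_mul_of_nonneg_right (by nlinarith [Real.sin_sq_le_one (b * t)]) (by positivity)

/-- **Krein form**: `(E(a₁) − E(a₂))² ≤ 2(∫t⁻²dμ) · E(a₁ − a₂)` — the Fejér energy is ½-Hölder in the
window, with modulus the energy AT THE DIFFERENCE WINDOW. -/
theorem sq_sub_fejerEnergy_le_krein {μ : Measure ℝ} (hM : Integrable (fun t : ℝ ↦ (t ^ 2)⁻¹) μ) (a₁ a₂ : ℝ) :
    ((∫ t, 2 * Real.sin (a₁ * t) ^ 2 / t ^ 2 ∂μ) - ∫ t, 2 * Real.sin (a₂ * t) ^ 2 / t ^ 2 ∂μ) ^ 2 ≤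
      (2 * ∫ t, (t ^ 2)⁻¹ ∂μ) * ∫ t, 2 * Real.sin ((a₁ - a₂) * t) ^ 2 / t ^ 2 ∂μ := by
  have h := sq_sub_fejerEnergy_le hM a₁ a₂
  have h1 := fejerEnergy_le hM (a₁ + a₂)
  have h2 : 0 ≤ ∫ t, 2 * Real.sin ((a₁ - a₂) * t) ^ 2 / t ^ 2 ∂μ := integral_nonneg fun t ↦ by positivity
  nlinarith

/-! ## In rung language: the defects at `a₁, a₂, a₁+a₂, a₁−a₂` -/

/-- **THE CROSS-WINDOW LAW FOR RUNG DEFECTS.**  Let `q ≠ 1` and let `μ` represent `Q_χ` on every test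
(all windows), and write `D(a) = log q − K_κ + I_κ(a)/a − 2S_χ(a) − 2a·μ{0}` (the defect of the flat-window
rung inequality at window `a`; `a·D(a) = ∫2sin²(at)/t²dμ`, `flatWindow_defect_eq`).  Then for all
`a₁ > a₂ > 0`:

  `(a₁D(a₁) − a₂D(a₂))² ≤ (a₁+a₂)D(a₁+a₂) · (a₁−a₂)D(a₁−a₂)`

— the rung inequalities at different windows are NOT independent: the four smoothed prime sums
`S_χ(a₁), S_χ(a₂), S_χ(a₁ ± a₂)` satisfy a quadratic constraint (for `a₁ − a₂ ≤ (log 2)/2` the last defect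
is prime-free and explicit).  RH/GRH-free at the measure level; under GRH a relation among prime sums. -/
theorem sq_sub_defect_le (hq : q ≠ 1) (χ : DirichletCharacter ℂ q) {μ : Measure ℝ}
    (hμ : ∀ g : ℝ → ℂ, IsWeilTest g →
      Integrable (fun t : ℝ ↦ ‖weilMellin g (1 / 2 + t * I)‖ ^ 2) μ ∧
        weilQuadraticChar χ g = ((∫ t, ‖weilMellin g (1 / 2 + t * I)‖ ^ 2 ∂μ : ℝ) : ℂ))
    (hM : Integrable (fun t : ℝ ↦ (t ^ 2)⁻¹) μ) {a₁ a₂ : ℝ} (ha₂ : 0 < a₂) (h12 : a₂ < a₁) :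
    let D : ℝ → ℝ := fun a ↦ Real.log q -
          (Real.log (4 * π) + Real.eulerMascheroniConstant +
            2 * ∫ t in Ioi (0 : ℝ), weilKillingDensityPar (charParity χ) t) +
          1 / a * (∫ t in Ioi (0 : ℝ), weilArchDensityPar (charParity χ) t * min t (2 * a)) -
          2 * (∑ n ∈ weilPrimeIndex a,
            (Λ n : ℝ) / Real.sqrt n * ((1 - Real.log n / (2 * a)) * (χ (n : ZMod q)).re)) -
          2 * a * μ.real {0}
    (a₁ * D a₁ - a₂ * D a₂) ^ 2 ≤ ((a₁ + a₂) * D (a₁ + a₂)) * ((a₁ - a₂) * D (a₁ - a₂)) := by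
  intro D
  have ha₁ : 0 < a₁ := ha₂.trans h12
  have hE : ∀ a : ℝ, 0 < a → a * D a = ∫ t, 2 * Real.sin (a * t) ^ 2 / t ^ 2 ∂μ := by
    intro a ha
    obtain ⟨hF, heq⟩ := flatWindow_defect_eq hq χ ha (fun g hg _ ↦ hμ g hg)
    show a * (Real.log q -
          (Real.log (4 * π) + Real.eulerMascheroniConstant +
            2 * ∫ t in Ioi (0 : ℝ), weilKillingDensityPar (charParity χ) t) +
          1 / a * (∫ t in Ioi (0 : ℝ), weilArchDensityPar (charParity χ) t * min t (2 * a)) -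
          2 * (∑ n ∈ weilPrimeIndex a,
            (Λ n : ℝ) / Real.sqrt n * ((1 - Real.log n / (2 * a)) * (χ (n : ZMod q)).re)) -
          2 * a * μ.real {0}) = _
    rw [heq, ← integral_const_mul]
    refine integral_congr_ae (Eventually.of_forall fun t ↦ ?_)
    show a * (2 * Real.sin (a * t) ^ 2 / (a * t ^ 2)) = 2 * Real.sin (a * t) ^ 2 / t ^ 2
    rcases eq_or_ne t 0 with rfl | ht
    · simp
    · field_simp
  rw [hE a₁ ha₁, hE a₂ ha₂, hE (a₁ + a₂) (by linarith), hE (a₁ - a₂) (by linarith)]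
  exact sq_sub_fejerEnergy_le hM a₁ a₂

end Summit.Ventures.WeilGRH

end
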